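import Mathlib

/-!
# Peeling, file 10: the factorisation `∂² − U = −A*A`, `∂² − Ũ = −AA*` and nilpotent tower data

Support file for `stub_peel` of the line `crum-peeling-recessive-tower` (crux
`UniformPhotonSphereChannelsR`, stmt-FinalStateConjecture-14074).  Pure one-variable calculus on an
open set `S` for functions smooth on `S` (all identities are `Set.EqOn … S`; outside `S` the global
functions carry junk values):

* the operators `L_U f = f'' − U f`, `A f = f' − W f`, `A* f = −f' − W f` (written inline with
  `iteratedDeriv 2` / `deriv`), their smoothness and congruence on `S`;
* `opL_eq_neg_opAs_opA` : `L_U f = −A*(A f)` and `opL_eq_neg_opA_opAs` : `L_Ũ f = −A(A* f)` on `S`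
  when `W' = U − W²`, `Ũ = 2W² − U`;
* `iterate_opL_opAs` : `L_U^m (A* h) = A* (L_Ũ^m h)` on `S` — so the descent of tower data
  `β = −A* α̃`, `A α = β̃` raises the nilpotency index by one (`towerData_descend`).
-/

noncomputable section

-- the doubled `FinalStateConjecture` component is the tree's fixed summit/problem path
set_option linter.dupNamespace false

namespace Summit.FinalStateConjecture.FinalStateConjecture.Theorems.CrumPeelingRecessiveTower

open Set Filter Topology
open scoped ContDiff

variable {S : Set ℝ}

/-! ### Smoothness and congruence of the operators -/

/-- `iteratedDeriv 2 f = deriv (deriv f)`. -/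
theorem iteratedDeriv_two_eq_deriv_deriv (f : ℝ → ℝ) : iteratedDeriv 2 f = deriv (deriv f) := by
  rw [iteratedDeriv_succ, iteratedDeriv_one]

/-- Smoothness of `deriv` on an open set. -/
theorem contDiffOn_deriv_infty (hS : IsOpen S) {f : ℝ → ℝ} (hf : ContDiffOn ℝ ∞ f S) :
    ContDiffOn ℝ ∞ (deriv f) S := hf.deriv_of_isOpen hS le_rfl

/-- Smoothness of `L_U f = f'' − U f` on an open set. -/
theorem contDiffOn_opL (hS : IsOpen S) {U f : ℝ → ℝ} (hU : ContDiffOn ℝ ∞ U S)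
    (hf : ContDiffOn ℝ ∞ f S) : ContDiffOn ℝ ∞ (fun x => iteratedDeriv 2 f x - U x * f x) S := by
  rw [iteratedDeriv_two_eq_deriv_deriv]
  exact (contDiffOn_deriv_infty hS (contDiffOn_deriv_infty hS hf)).sub (hU.mul hf)

/-- Smoothness of `A f = f' − W f` / `A* f = −f' − W f` type expressions on an open set. -/
theorem contDiffOn_opA (hS : IsOpen S) {W f : ℝ → ℝ} (hW : ContDiffOn ℝ ∞ W S)
    (hf : ContDiffOn ℝ ∞ f S) (σ : ℝ) : ContDiffOn ℝ ∞ (fun x => σ * deriv f x - W x * f x) S :=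
  (contDiffOn_const.mul (contDiffOn_deriv_infty hS hf)).sub (hW.mul hf)

/-- Congruence of `deriv` on an open set. -/
theorem eqOn_deriv (hS : IsOpen S) {f g : ℝ → ℝ} (h : EqOn f g S) : EqOn (deriv f) (deriv g) S :=
  fun _ hx => (Filter.eventuallyEq_of_mem (hS.mem_nhds hx) h).deriv_eq

/-- Congruence of `iteratedDeriv 2` on an open set. -/
theorem eqOn_iteratedDeriv_two (hS : IsOpen S) {f g : ℝ → ℝ} (h : EqOn f g S) :
    EqOn (iteratedDeriv 2 f) (iteratedDeriv 2 g) S :=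
  fun _ hx => (Filter.eventuallyEq_of_mem (hS.mem_nhds hx) h).iteratedDeriv_eq 2

/-- Congruence of `L_U` on an open set. -/
theorem eqOn_opL (hS : IsOpen S) (U : ℝ → ℝ) {f g : ℝ → ℝ} (h : EqOn f g S) :
    EqOn (fun x => iteratedDeriv 2 f x - U x * f x) (fun x => iteratedDeriv 2 g x - U x * g x) S :=
  fun x hx => by
    show iteratedDeriv 2 f x - U x * f x = iteratedDeriv 2 g x - U x * g x
    rw [eqOn_iteratedDeriv_two hS h hx, h hx]

/-- Congruence of the iterates `L_U^m` on an open set. -/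
theorem eqOn_iterate_opL (hS : IsOpen S) (U : ℝ → ℝ) (m : ℕ) {f g : ℝ → ℝ} (h : EqOn f g S) :
    EqOn ((fun (f : ℝ → ℝ) (x : ℝ) => iteratedDeriv 2 f x - U x * f x)^[m] f)
      ((fun (f : ℝ → ℝ) (x : ℝ) => iteratedDeriv 2 f x - U x * f x)^[m] g) S := by
  induction m generalizing f g with
  | zero => simpa using h
  | succ m ih =>
    rw [Function.iterate_succ_apply, Function.iterate_succ_apply]
    exact ih (eqOn_opL hS U h)

/-- Smoothness of the iterates `L_U^m f`. -/
theorem contDiffOn_iterate_opL (hS : IsOpen S) {U : ℝ → ℝ} (hU : ContDiffOn ℝ ∞ U S) (m : ℕ)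
    {f : ℝ → ℝ} (hf : ContDiffOn ℝ ∞ f S) :
    ContDiffOn ℝ ∞ ((fun (f : ℝ → ℝ) (x : ℝ) => iteratedDeriv 2 f x - U x * f x)^[m] f) S := by
  induction m generalizing f with
  | zero => simpa using hf
  | succ m ih =>
    rw [Function.iterate_succ_apply]
    exact ih (contDiffOn_opL hS hU hf)

/-- `L_U 0 = 0` and `L_U^m 0 = 0` (globally). -/
theorem iterate_opL_zero (U : ℝ → ℝ) (m : ℕ) :
    (fun (f : ℝ → ℝ) (x : ℝ) => iteratedDeriv 2 f x - U x * f x)^[m] (fun _ => 0) = fun _ => 0 := by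
  induction m with
  | zero => rfl
  | succ m ih =>
    rw [Function.iterate_succ_apply]
    have : (fun x => iteratedDeriv 2 (fun _ : ℝ => (0 : ℝ)) x - U x * (fun _ : ℝ => (0 : ℝ)) x)
        = fun _ => 0 := by
      funext x; simp
    rw [this, ih]

/-- `L_U^m (−f) = −L_U^m f` (globally). -/
theorem iterate_opL_neg (U : ℝ → ℝ) (m : ℕ) (f : ℝ → ℝ) :
    (fun (f : ℝ → ℝ) (x : ℝ) => iteratedDeriv 2 f x - U x * f x)^[m] (fun x => -f x)
      = fun x => -((fun (f : ℝ → ℝ) (x : ℝ) => iteratedDeriv 2 f x - U x * f x)^[m] f x) := by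
  induction m generalizing f with
  | zero => rfl
  | succ m ih =>
    rw [Function.iterate_succ_apply, Function.iterate_succ_apply]
    have : (fun x => iteratedDeriv 2 (fun x => -f x) x - U x * (fun x => -f x) x)
        = fun x => -(iteratedDeriv 2 f x - U x * f x) := by
      funext x
      have h : (fun x => -f x) = -f := rfl
      rw [h, iteratedDeriv_neg]
      simp only [Pi.neg_apply]
      ring
    rw [this, ih]

/-! ### The factorisations -/

/-- **`L_U f = −A*(A f)`** on `S`: with `A f = f' − W f`, `A* g = −g' − W g` and `W' = U − W²`,
`f'' − U f = (A f)' + W (A f)`. -/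
theorem opL_eq_neg_opAs_opA (hS : IsOpen S) {W U f : ℝ → ℝ} (hW : ∀ x ∈ S, HasDerivAt W (U x - W x ^ 2) x)
    (hf : ContDiffOn ℝ ∞ f S) :
    EqOn (fun x => iteratedDeriv 2 f x - U x * f x)
      (fun x => deriv (fun y => deriv f y - W y * f y) x + W x * (deriv f x - W x * f x)) S := by
  intro x hx
  have hfd : ∀ y ∈ S, HasDerivAt f (deriv f y) y := fun y hy =>
    ((hf.differentiableOn (by simp) y hy).differentiableAt (hS.mem_nhds hy)).hasDerivAt
  have hf'C : ContDiffOn ℝ ∞ (deriv f) S := contDiffOn_deriv_infty hS hf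
  have hf'd : HasDerivAt (deriv f) (deriv (deriv f) x) x :=
    ((hf'C.differentiableOn (by simp) x hx).differentiableAt (hS.mem_nhds hx)).hasDerivAt
  have hA : HasDerivAt (fun y => deriv f y - W y * f y)
      (deriv (deriv f) x - ((U x - W x ^ 2) * f x + W x * deriv f x)) x :=
    hf'd.sub ((hW x hx).mul (hfd x hx))
  simp only
  rw [hA.deriv, iteratedDeriv_two_eq_deriv_deriv]
  ring

/-- **`L_Ũ g = −A(A* g)`** on `S`: with `Ũ = 2W² − U`, `g'' − Ũ g = −((A* g)' − W (A* g))`. -/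
theorem opL_eq_neg_opA_opAs (hS : IsOpen S) {W U Ut g : ℝ → ℝ}
    (hW : ∀ x ∈ S, HasDerivAt W (U x - W x ^ 2) x) (hUt : ∀ x ∈ S, Ut x = 2 * W x ^ 2 - U x)
    (hg : ContDiffOn ℝ ∞ g S) :
    EqOn (fun x => iteratedDeriv 2 g x - Ut x * g x)
      (fun x => -(deriv (fun y => -deriv g y - W y * g y) x - W x * (-deriv g x - W x * g x))) S := by
  intro x hx
  have hgd : ∀ y ∈ S, HasDerivAt g (deriv g y) y := fun y hy =>
    ((hg.differentiableOn (by simp) y hy).differentiableAt (hS.mem_nhds hy)).hasDerivAt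
  have hg'C : ContDiffOn ℝ ∞ (deriv g) S := contDiffOn_deriv_infty hS hg
  have hg'd : HasDerivAt (deriv g) (deriv (deriv g) x) x :=
    ((hg'C.differentiableOn (by simp) x hx).differentiableAt (hS.mem_nhds hx)).hasDerivAt
  have hA : HasDerivAt (fun y => -deriv g y - W y * g y)
      (-deriv (deriv g) x - ((U x - W x ^ 2) * g x + W x * deriv g x)) x :=
    hg'd.neg.sub ((hW x hx).mul (hgd x hx))
  simp only
  rw [hA.deriv, iteratedDeriv_two_eq_deriv_deriv, hUt x hx]
  ring

/-- **Intertwining of the iterates**: `L_U^m (A* h) = A* (L_Ũ^m h)` on `S`. -/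
theorem iterate_opL_opAs (hS : IsOpen S) {W U Ut : ℝ → ℝ} (hWC : ContDiffOn ℝ ∞ W S)
    (hUtC : ContDiffOn ℝ ∞ Ut S)
    (hW : ∀ x ∈ S, HasDerivAt W (U x - W x ^ 2) x) (hUt : ∀ x ∈ S, Ut x = 2 * W x ^ 2 - U x)
    (m : ℕ) {h : ℝ → ℝ} (hh : ContDiffOn ℝ ∞ h S) :
    EqOn ((fun (f : ℝ → ℝ) (x : ℝ) => iteratedDeriv 2 f x - U x * f x)^[m]
        (fun x => -deriv h x - W x * h x))
      (fun x => -deriv ((fun (f : ℝ → ℝ) (x : ℝ) => iteratedDeriv 2 f x - Ut x * f x)^[m] h) x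
        - W x * ((fun (f : ℝ → ℝ) (x : ℝ) => iteratedDeriv 2 f x - Ut x * f x)^[m] h) x) S := by
  induction m generalizing h with
  | zero => exact fun x _ => rfl
  | succ m ih =>
    -- `L_U (A* h) = A* (L_Ũ h)` on `S`
    have hAs : ContDiffOn ℝ ∞ (fun x => -deriv h x - W x * h x) S := by
      have := contDiffOn_opA hS hWC hh (-1)
      simpa using this
    have hLh : ContDiffOn ℝ ∞ (fun x => iteratedDeriv 2 h x - Ut x * h x) S := contDiffOn_opL hS hUtC hh
    have step : EqOn (fun x => iteratedDeriv 2 (fun y => -deriv h y - W y * h y) x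
        - U x * (fun y => -deriv h y - W y * h y) x)
        (fun x => -deriv (fun y => iteratedDeriv 2 h y - Ut y * h y) x
          - W x * (iteratedDeriv 2 h x - Ut x * h x)) S := by
      intro x hx
      -- left: `L_U (A* h) = (A (A* h))' + W (A (A* h))`; and `A (A* h) = −L_Ũ h`
      have h1 := opL_eq_neg_opAs_opA hS hW hAs hx
      have h2 : EqOn (fun y => deriv (fun z => -deriv h z - W z * h z) y - W y * (-deriv h y - W y * h y))
          (fun y => -(iteratedDeriv 2 h y - Ut y * h y)) S := by
        intro y hy
        have := opL_eq_neg_opA_opAs hS hW hUt hh hy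
        simp only at this ⊢
        linarith
      have h2x := h2 hx
      simp only at h1 h2x ⊢
      rw [h1, eqOn_deriv hS h2 hx, h2x]
      have h3 : deriv (fun y => -(iteratedDeriv 2 h y - Ut y * h y)) x
          = -deriv (fun y => iteratedDeriv 2 h y - Ut y * h y) x := by
        have : (fun y => -(iteratedDeriv 2 h y - Ut y * h y)) = -(fun y => iteratedDeriv 2 h y - Ut y * h y) := rfl
        rw [this, deriv.neg]
      rw [h3]
      ring
    intro x hx
    rw [Function.iterate_succ_apply, Function.iterate_succ_apply]
    rw [eqOn_iterate_opL hS U m step hx]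
    exact ih hLh hx

/-! ### Descent of nilpotent tower data -/

/-- **Tower data descend through a rung.**  Let `α̃, β̃` be smooth on `S` and killed by `L_Ũ^m`
on `S`.  If `α, β` are smooth on `S` with `β = α̃' + W α̃` and `α' − W α = β̃` on `S`, then
`α, β` are killed by `L_U^{m+1}` on `S`. -/
theorem towerData_descend (hS : IsOpen S) {W U Ut : ℝ → ℝ} (hWC : ContDiffOn ℝ ∞ W S)
    (hUtC : ContDiffOn ℝ ∞ Ut S)
    (hW : ∀ x ∈ S, HasDerivAt W (U x - W x ^ 2) x) (hUt : ∀ x ∈ S, Ut x = 2 * W x ^ 2 - U x)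
    {m : ℕ} {αt βt α β : ℝ → ℝ} (hαt : ContDiffOn ℝ ∞ αt S) (hβt : ContDiffOn ℝ ∞ βt S)
    (hα : ContDiffOn ℝ ∞ α S)
    (hkα : EqOn ((fun (f : ℝ → ℝ) (x : ℝ) => iteratedDeriv 2 f x - Ut x * f x)^[m] αt) (fun _ => 0) S)
    (hkβ : EqOn ((fun (f : ℝ → ℝ) (x : ℝ) => iteratedDeriv 2 f x - Ut x * f x)^[m] βt) (fun _ => 0) S)
    (hβdef : EqOn β (fun x => deriv αt x + W x * αt x) S)
    (hαrel : EqOn (fun x => deriv α x - W x * α x) βt S) :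
    EqOn ((fun (f : ℝ → ℝ) (x : ℝ) => iteratedDeriv 2 f x - U x * f x)^[m + 1] α) (fun _ => 0) S ∧
    EqOn ((fun (f : ℝ → ℝ) (x : ℝ) => iteratedDeriv 2 f x - U x * f x)^[m + 1] β) (fun _ => 0) S := by
  set L : (ℝ → ℝ) → ℝ → ℝ := fun f x => iteratedDeriv 2 f x - U x * f x with hL
  set Lt : (ℝ → ℝ) → ℝ → ℝ := fun f x => iteratedDeriv 2 f x - Ut x * f x with hLt
  constructor
  · -- `L α = −A* (A α) = −A* β̃ = A*(−β̃)… : L^{m+1} α = L^m (A* (−β̃)) = A* (Lt^m (−β̃)) = 0`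
    have h1 : EqOn (L α) (fun x => -deriv (fun y => -βt y) x - W x * (fun y => -βt y) x) S := by
      intro x hx
      have e1 := opL_eq_neg_opAs_opA hS hW hα hx
      have hαx := hαrel hx
      simp only [hL] at e1 hαx ⊢
      rw [e1, eqOn_deriv hS hαrel hx, hαx]
      have : deriv (fun y => -βt y) x = -deriv βt x := by
        rw [show (fun y => -βt y) = -βt from rfl, deriv.neg]
      rw [this]; ring
    intro x hx
    rw [Function.iterate_succ_apply, eqOn_iterate_opL hS U m h1 hx,
      iterate_opL_opAs hS hWC hUtC hW hUt m hβt.neg hx]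
    have hneg := iterate_opL_neg Ut m βt
    simp only [] at hneg ⊢
    rw [hneg]
    have hz : EqOn (fun x => -(Lt^[m] βt x)) (fun _ => 0) S := fun y hy => by
      simp only [hLt]; rw [hkβ hy]; simp
    rw [eqOn_deriv hS hz hx, hz hx]
    simp
  · -- `β = −A* α̃ : L^m β = −L^m (A* α̃) = −A*(Lt^m α̃) = 0`, hence `L^{m+1} β = L 0 = 0`
    have h1 : EqOn β (fun x => -(-deriv αt x - W x * αt x)) S := fun x hx => by
      rw [hβdef hx]; ring
    have hm : EqOn (L^[m] β) (fun _ => 0) S := by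
      intro x hx
      rw [eqOn_iterate_opL hS U m h1 hx]
      have hneg := iterate_opL_neg U m (fun x => -deriv αt x - W x * αt x)
      simp only [] at hneg ⊢
      rw [hneg]
      simp only []
      rw [iterate_opL_opAs hS hWC hUtC hW hUt m hαt hx]
      simp only []
      rw [eqOn_deriv hS hkα hx, hkα hx]
      simp
    intro x hx
    rw [Function.iterate_succ_apply']
    have : EqOn (L (L^[m] β)) (L (fun _ => 0)) S := eqOn_opL hS U hm
    rw [this hx]
    simp [hL]

/-- Registered sub-goal `peel_iterateOpLNeg` of `stub_peel` (verbatim signature): linearity `L_U^m (−f) = −L_U^m f` of the iterated operator `L_U f = f'' − U f`. -/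
theorem peel_iterateOpLNeg : ∀ (U : ℝ → ℝ) (m : ℕ) (f : ℝ → ℝ), (fun (f : ℝ → ℝ) (x : ℝ) => iteratedDeriv 2 f x - U x * f x)^[m] (fun x => -f x) = fun x => -((fun (f : ℝ → ℝ) (x : ℝ) => iteratedDeriv 2 f x - U x * f x)^[m] f x) :=
  fun U m f => iterate_opL_neg U m f

end Summit.FinalStateConjecture.FinalStateConjecture.Theorems.CrumPeelingRecessiveTower
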